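import Literature.Topology.FourManifolds.RoundSolidTorus
import Literature.Topology.FourManifolds.LickorishWallaceLeaves
import Literature.Topology.FourManifolds.HandlebodySymmetricModels
import Literature.Topology.FourManifolds.TrisectionFunctorGKCentralSurface
import Literature.Topology.Euclidean.QuarticTorus
import HarnessLib

/-!
# The boundary of a genus-one handlebody is a torus, marked by `S_1`; (g′) in genus one

Topic `Literature/Topology/FourManifolds`; assembly file for the genus-`1` case of the named fact
(g′) `exists_marking_centralSurface_of_gkTrisection` (`TrisectionFunctorGK.lean`; fact seat
`provefact-Literature.Topology.FourManifolds.exists-cbed50d78a`), joining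

* `RoundSolidTorus.lean` — a genus-`1` handlebody `V` (`IsHandlebody 1`, proved) whose boundary
  is the torus of revolution `{(x² + y² − 4)² + 16 z² = 1}`;
* `Literature/Topology/Euclidean/QuarticTorus.lean` — that torus is homeomorphic to
  `ℝ/2πℤ × ℝ/2πℤ`;
* `TrisectionFunctorGKCentralSurface.lean` — tori, and spaces homeomorphic to tori, are marked by
  the genus-`1` surface group `S_1 = ⟨a, b ∣ aba⁻¹b⁻¹⟩` (Hatcher, Thm. 1.7, Prop. 1.12,
  Example 1.13, §1.2 p. 51), and `exists_marking_centralSurface_of_homeomorph`;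
* `LickorishWallaceLeaves.lean` — uniqueness of genus-`g` handlebodies
  (`IsHandlebody.nonempty_diffeomorph_of_oneHandle`, Kosinski VI (11.4)(c)) from the named fact
  L1 `oneHandle_nonempty_diffeomorph` (uniqueness of attaching one `1`-handle, Kosinski VI
  (6.6); `HandlebodyClassification.lean`), and `HandlebodySymmetricModels.lean` (`ULift`).

## Results (all proved; no new named facts; conditional results take L1 as a hypothesis)

* `Diffeomorph.boundaryHomeomorph` — a diffeomorphism restricts to `∂M ≃ₜ ∂N` (Mathlib's
  `Diffeomorph.image_boundary`; dot-notation extension of Mathlib's `Diffeomorph`).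
* `RoundSolidTorusModel.boundaryHomeomorphAngle/AddCircle : ∂V ≃ₜ ℝ/2πℤ × ℝ/2πℤ`,
  `RoundSolidTorusModel.nonempty_marking_boundary : Nonempty (S_1 ≃* π₁(∂V, z))`.
* `IsHandlebody.nonempty_homeomorph_boundary_torus_of_oneHandle` — **granted L1, the boundary
  of every genus-`1` handlebody is a torus**; `IsHandlebody.nonempty_marking_boundary_of_oneHandle`
  — and is marked by `S_1` at every point (Schultens (2014), Def. 6.1.5: "the genus of a
  handlebody is the genus of its boundary"; the solid torus, Example 6.1.9).
* `exists_marking_centralSurface_of_isHandlebody_one`,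
  `exists_marking_centralSurface_of_gkTrisection_genusOne_of_isOrientable` — **(g′) for `g = 1`
  holds granted L1 and the orientability of the handlebody `H₀₁` of clause (iii)** of
  `IsGKTrisection` (Gay–Kirby, Def. 1 / Remark 2, assume `H_{ij}` is a genus-`g` handlebody,
  in particular orientable; clause (iii) of the tree's predicate records compactness,
  connectedness and the handle decomposition but not orientability, which has to be derived
  from the embedding of `H_{ij}` as a two-sided hypersurface of the oriented `X` — not yet in the
  tree).  Thus the genus-`1` clause of (g′) is reduced to exactly two inputs: L1 and that
  orientability.

## References

* D. Gay, R. Kirby, *Trisecting 4-manifolds*, Geom. Topol. 20 (2016), Def. 1 and Remark 2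
  (p. 3098). [GayKirby2016]
* A. Hatcher, *Algebraic Topology*, CUP (2002), Thm. 1.7, Prop. 1.12, Example 1.13, Prop. 1.18,
  §1.2 p. 51. [HatcherAT2002]
* A. A. Kosinski, *Differential Manifolds*, Academic Press (1993), VI (6.6), (11.4)(c).
  [Kosinski1993]
* J. Schultens, *Introduction to 3-Manifolds*, GSM 151, AMS (2014), Def. 6.1.5, Example 6.1.9.
  [Schultens2014]
-/

open scoped Manifold ContDiff Topology
open Set Function

noncomputable section

universe u v

/-! ### Boundaries of diffeomorphic manifolds with boundary are homeomorphic -/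

section DiffeoBoundary

variable {E H H' : Type*} [NormedAddCommGroup E] [NormedSpace ℝ E] [TopologicalSpace H]
  [TopologicalSpace H'] {I : ModelWithCorners ℝ E H} {I' : ModelWithCorners ℝ E H'}
  {M : Type u} [TopologicalSpace M] [ChartedSpace H M]
  {N : Type v} [TopologicalSpace N] [ChartedSpace H' N] {n : WithTop ℕ∞}

/-- **A `Cⁿ` diffeomorphism (`n ≠ 0`) restricts to a homeomorphism of the boundaries**
`∂M ≃ₜ ∂N`: diffeomorphisms carry boundary points to boundary points (Mathlib,
`Diffeomorph.image_boundary`).  Deliberate dot-notation extension of Mathlib's `Diffeomorph`,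
declared with its root name. [folklore] -/
def Diffeomorph.boundaryHomeomorph (Φ : M ≃ₘ^n⟮I, I'⟯ N) (hn : n ≠ 0) :
    ↥(I.boundary M) ≃ₜ ↥(I'.boundary N) :=
  (Φ.toHomeomorph.image (I.boundary M)).trans (Homeomorph.setCongr (Φ.image_boundary hn))

/-- The boundary homeomorphism is the restriction of `Φ`. [folklore] -/
@[simp] theorem Diffeomorph.boundaryHomeomorph_apply_coe (Φ : M ≃ₘ^n⟮I, I'⟯ N) (hn : n ≠ 0)
    (z : I.boundary M) : (Φ.boundaryHomeomorph hn z : N) = Φ z := rfl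

end DiffeoBoundary

namespace Literature.Topology.FourManifolds

/-- Local notation: `𝔼 n` is the model Euclidean space `EuclideanSpace ℝ (Fin n)`. -/
local notation "𝔼 " n:arg => EuclideanSpace ℝ (Fin n)

namespace RoundSolidTorusModel

open Literature.Topology.Euclidean

/-- The boundary torus `{G = 0} = {(x² + y² - 4)² + 16 z² = 1}` of the round solid torus is the
torus of revolution `quarticTorus 4 1 (1/4)` of `QuarticTorus.lean`. [folklore] -/
theorem setOf_G_eq_zero : {p : 𝔼 3 | G p = 0} = quarticTorus 4 1 (1 / 4) := by
  ext p
  simp only [mem_setOf_eq, mem_quarticTorus_iff, G]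
  constructor
  · intro h; linear_combination h / 16
  · intro h; linear_combination 16 * h

/-- **The boundary of the round solid torus is homeomorphic to `S¹ × S¹`** (longitude and
meridian angle of the torus of revolution; `torusHomeomorph` of `QuarticTorus.lean`).
[folklore] -/
def boundaryHomeomorphAngle :
    ↥((𝓡∂ 3).boundary RoundSolidTorus) ≃ₜ Real.Angle × Real.Angle :=
  boundaryHomeomorph.trans ((Homeomorph.setCongr setOf_G_eq_zero).trans
    (torusHomeomorph (a := 4) (r := 1) (e := 1 / 4) (by norm_num) one_pos (by norm_num)).symm)

/-- The same homeomorphism with the factors written as `AddCircle (2π)`. [folklore] -/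
def boundaryHomeomorphAddCircle :
    ↥((𝓡∂ 3).boundary RoundSolidTorus) ≃ₜ AddCircle (2 * Real.pi) × AddCircle (2 * Real.pi) :=
  boundaryHomeomorphAngle

/-- **The boundary of the round solid torus is marked by the genus-`1` surface group** at every
base point: `S_1 ≃* π₁(∂V, z)` (torus of revolution ≅ `S¹ × S¹`, Hatcher Example 1.13 and §1.2
p. 51 via `nonempty_marking_of_homeomorph_torus`). [cite: HatcherAT2002, Example 1.13 (p. 34) and §1.2 p. 51] -/
theorem nonempty_marking_boundary (z : (𝓡∂ 3).boundary RoundSolidTorus) :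
    Nonempty (SurfaceGroup 1 ≃* FundamentalGroup ((𝓡∂ 3).boundary RoundSolidTorus) z) :=
  nonempty_marking_of_homeomorph_torus Real.two_pi_pos.ne' Real.two_pi_pos.ne'
    boundaryHomeomorphAddCircle z

end RoundSolidTorusModel

/-! ### Every genus-one handlebody (given the `1`-handle lemma L1) -/

section GenusOne

open RoundSolidTorusModel

variable {H : Type u} [TopologicalSpace H] [T2Space H] [SecondCountableTopology H]
  [ChartedSpace (EuclideanHalfSpace 3) H] [IsManifold (𝓡∂ 3) ∞ H]

/-- **The boundary of a genus-`1` handlebody is a torus** — granted the uniqueness of attaching a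
`1`-handle `oneHandle_nonempty_diffeomorph` (L1, `HandlebodyClassification.lean`; Kosinski (1993),
VI (6.6)): by the classification of genus-`g` handlebodies from L1
(`IsHandlebody.nonempty_diffeomorph_of_oneHandle`; Kosinski VI (11.4)(c)) `H` is diffeomorphic to
(the universe lift of) the round solid torus `RoundSolidTorus`, whose boundary is the torus of
revolution `≅ S¹ × S¹`; diffeomorphisms preserve boundaries.  Schultens (2014), Def. 6.1.5 /
Example 6.1.9: the genus of a handlebody is the genus of its boundary; the solid torus has
boundary the torus. [cite: Kosinski1993, VI (11.4)(c)] [cite: Schultens2014, Def. 6.1.5] -/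
theorem IsHandlebody.nonempty_homeomorph_boundary_torus_of_oneHandle
    (h₁ : oneHandle_nonempty_diffeomorph.{u}) (hH : IsHandlebody 1 H) :
    Nonempty (↥((𝓡∂ 3).boundary H) ≃ₜ AddCircle (2 * Real.pi) × AddCircle (2 * Real.pi)) := by
  have hV : IsHandlebody 1 (ULift.{u} RoundSolidTorus) :=
    ManifoldULift.isHandlebody isHandlebody_one_roundSolidTorus
  obtain ⟨Φ⟩ := IsHandlebody.nonempty_diffeomorph_of_oneHandle h₁ 1 H (ULift.{u} RoundSolidTorus)
    hH hV
  exact ⟨(Φ.boundaryHomeomorph (by simp)).trans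
    (((ManifoldULift.diffeomorph (𝓡∂ 3) RoundSolidTorus ∞).boundaryHomeomorph (by simp)).trans
      boundaryHomeomorphAddCircle)⟩

/-- **The boundary of a genus-`1` handlebody is marked by `S_1` at every base point** (granted
L1): `S_1 = ⟨a, b ∣ aba⁻¹b⁻¹⟩ ≃* π₁(∂H, z)`, since `∂H` is a torus
(`IsHandlebody.nonempty_homeomorph_boundary_torus_of_oneHandle`) and tori are marked by `S_1`
(Hatcher, Example 1.13 and §1.2 p. 51).  This is the genus-`1` case of "the boundary of a genus-`g`
handlebody is the closed orientable surface of genus `g`" needed by Gay–Kirby's Remark 2 for the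
central surface of a trisection. [cite: Schultens2014, Def. 6.1.5] [cite: HatcherAT2002, Example 1.13 (p. 34) and §1.2 p. 51] -/
theorem IsHandlebody.nonempty_marking_boundary_of_oneHandle
    (h₁ : oneHandle_nonempty_diffeomorph.{u}) (hH : IsHandlebody 1 H) (z : (𝓡∂ 3).boundary H) :
    Nonempty (SurfaceGroup 1 ≃* FundamentalGroup ((𝓡∂ 3).boundary H) z) := by
  obtain ⟨e⟩ := hH.nonempty_homeomorph_boundary_torus_of_oneHandle h₁
  exact nonempty_marking_of_homeomorph_torus Real.two_pi_pos.ne' Real.two_pi_pos.ne' e z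

end GenusOne


/-! ### Genus-one trisections: (g′) from L1 and the orientability of `H₀₁` -/

section Trisection

variable {X : Type u} [TopologicalSpace X] [T2Space X] [SecondCountableTopology X]
  [ChartedSpace (EuclideanSpace ℝ (Fin 4)) X] {k : Fin 3 → ℕ} {S : Fin 3 → Set X}

omit [ChartedSpace (EuclideanSpace ℝ (Fin 4)) X] in
/-- **A genus-`1` handlebody embedded with boundary the central surface marks it** (granted L1):
if `f : H → X` is a topological embedding of a genus-`1` handlebody (`IsHandlebody 1 H`) with
`f(∂H) = F = ⋂ S l` non-empty, then `F` has a base point with a marking `S_1 ≃* π₁(F, x₀)` —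
`∂H` is a torus marked by `S_1` (`IsHandlebody.nonempty_marking_boundary_of_oneHandle`) and
`f|∂H : ∂H ≃ₜ F`.  This is Gay–Kirby's Remark 2 ("`F_g = ∂H_{ij}` is the central genus-`g`
surface") in genus `1`, for an *orientable* `H_{ij}`. [cite: GayKirby2016, Def. 1 and Remark 2 (p. 3098)]
[cite: HatcherAT2002, Example 1.13 (p. 34) and §1.2 p. 51] -/
theorem exists_marking_centralSurface_of_isHandlebody_one
    (h₁ : oneHandle_nonempty_diffeomorph.{u}) {H : Type u} [TopologicalSpace H]
    [ChartedSpace (EuclideanHalfSpace 3) H] [IsManifold (𝓡∂ 3) ∞ H] (hH : IsHandlebody 1 H)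
    (f : H → X) (hf : Topology.IsEmbedding f) (hbdry : f '' (𝓡∂ 3).boundary H = ⋂ l, S l)
    [Nonempty (centralSurface S)] :
    ∃ x₀ : centralSurface S, Nonempty (SurfaceGroup 1 ≃* FundamentalGroup (centralSurface S) x₀) := by
  haveI : T2Space H := hf.t2Space
  haveI : SecondCountableTopology H := hf.secondCountableTopology
  have hemb : Topology.IsEmbedding (fun z : (𝓡∂ 3).boundary H => f z.1) :=
    hf.comp Topology.IsEmbedding.subtypeVal
  have hrange : range (fun z : (𝓡∂ 3).boundary H => f z.1) = ⋂ l, S l := by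
    rw [← hbdry]
    ext x
    constructor
    · rintro ⟨z, rfl⟩
      exact ⟨z.1, z.2, rfl⟩
    · rintro ⟨y, hy, rfl⟩
      exact ⟨⟨y, hy⟩, rfl⟩
  let e : ↥((𝓡∂ 3).boundary H) ≃ₜ centralSurface S :=
    hemb.toHomeomorph.trans (Homeomorph.setCongr hrange)
  exact exists_marking_centralSurface_of_homeomorph e.symm
    (hH.nonempty_marking_boundary_of_oneHandle h₁)

/-- **(g′) in genus `1`, granted the `1`-handle lemma L1 and the orientability of the double
intersection `H₀₁`.**  For a `(1; k₀, k₁, k₂)`-trisection with corners along the central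
surface of a smooth Hausdorff second-countable 4-manifold, if the compact connected
`1`-handlebody `H` of clause (iii) for the sectors `S 0`, `S 1` is orientable — which Gay–Kirby
take for granted ("`H_{ij}` is a genus `g` handlebody", Def. 1 / Remark 2; in the tree this is the
outstanding input: `H ⊆ ∂X₁` is two-sided in the oriented `X`) — then the central surface `F`
has a base point and a marking `S_1 ≃* π₁(F, x₀)`.  With `IsOrientable` for the clause-(iii)
handlebody and L1 (`oneHandle_nonempty_diffeomorph`) discharged this is the genus-`1` clause of
the named fact `exists_marking_centralSurface_of_gkTrisection`.
[cite: GayKirby2016, Def. 1 and Remark 2 (p. 3098)] [cite: Kosinski1993, VI (11.4)(c)] -/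
theorem exists_marking_centralSurface_of_gkTrisection_genusOne_of_isOrientable
    (h₁ : oneHandle_nonempty_diffeomorph.{u}) (h : IsGKTrisection X 1 k S)
    (hO : ∀ (H : Type u) [TopologicalSpace H] [ChartedSpace (EuclideanHalfSpace 3) H]
      [IsManifold (𝓡∂ 3) ∞ H] (f : H → X), CompactSpace H → ConnectedSpace H →
      HasHandleDecomposition 2 H (handleCount 1 1) →
      Manifold.IsSmoothEmbedding (𝓡∂ 3) (𝓡 4) ∞ f → range f = S 0 ∩ S 1 →
      f '' (𝓡∂ 3).boundary H = (⋂ l, S l) → IsOrientable (𝓡∂ 3) H) :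
    ∃ x₀ : centralSurface S, Nonempty (SurfaceGroup 1 ≃* FundamentalGroup (centralSurface S) x₀) := by
  obtain ⟨H, _, _, f, hM, hc, hconn, hh, hf, hrange, hbdry⟩ := h.2.2 0 1 (by decide)
  haveI := hM
  haveI := hc
  haveI := hconn
  haveI := h.nonempty_centralSurface
  have ho : IsOrientable (𝓡∂ 3) H := hO H f hc hconn hh hf hrange hbdry
  exact exists_marking_centralSurface_of_isHandlebody_one h₁ ⟨hc, hconn, ho, hh⟩ f
    hf.isEmbedding hbdry

end Trisection

end Literature.Topology.FourManifolds

end
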